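import Summits.QuantumFields.YangMills.Theorems.FluctuationComparisonRegPrIntLOneBondFamily
import Mathlib.Topology.MetricSpace.Contracting
import HarnessLib

/-!
# `FluctuationComparisonRegPrIntLOneBondInverse` — THE ONE-BOND EXP-MEAN-LOG FIBRE MAP ON `SU(N)` IS A CONTRACTION-PERTURBED ROTATION:
# quantitative injectivity, a fixed-point inverse on a ball, and Lipschitz dependence on the target and on the environment

Cell `ym3-torus` (rung R3 = continuum `SU(2)` Yang–Mills on the three-torus — NOT d = 4, NOT infinite volume, NOT a mass gap, NOT Clay), width seat
`ym-ust-20520-w5` (gen 21), pen (B1′) «Stage 1, part 2» named by LEAD-20520 w3 g22 (2026-08-30): the TOPOLOGICAL half of the per-bond one-variable inverse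
law that `T4TriangularFibredChart` ∕ `…OrganTangentTriangularChart` (v2) display as hypotheses (`Ω T θ`, `hright`, `hleft`, `hθc`) for Bałaban's block
average [Balaban1987RG1] (0.4) in its PRIVATE coordinate (`BlockAveragingEMLHaarAC.fibreMap`: `W ↦ E(V_i W⁻¹)·W`, `E = expMeanLogSU.avg = exp[mean log]` on the
guard — `BlockAveragingEMLProp2.coe_avg_eq_eml`).  `--kind proof --supports stmt-QuantumFields-20520 --as helper`, count-neutral, definition-free, default heartbeats; THEOREMS ONLY (elementary
estimates about the tree's own objects); nothing printed is asserted.  Inputs: `FluctuationComparisonRegPrIntLOneBondFamily` (the `q := m∕|ι| + 144 r` Lipschitz bound and the size bound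
`(m∕|ι|) r + 36 r²` of `E_V`), `BlockAveragingEMLAnalyticMean.norm_eml_add_sub_eml_le` (`12`).

## Content (one-bond map `F_V(W) := expMeanLogSU.avg (i ↦ (p i ? 1 : V_i·W⁻¹)) · W`, `m` = number of off-central indices `¬p i`)

* ★ **`oneBond_injOn`** — `F_V` is INJECTIVE on `{W : ∀ ¬p i, ‖V_i − W‖ ≤ r}` (`r ≤ 1∕24`, `r < δ_N`) as soon as `q < 1`
  (`F W₁ = F W₂ ⇒ W₁ − W₂ = E₁*(E₂ − E₁)W₂ ⇒ ‖W₁ − W₂‖ ≤ q‖W₁ − W₂‖`).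
* ★★ **`oneBond_exists_preimage`** — centre `V̄ ∈ SU(N)`, spread `‖V_i − V̄‖ ≤ s` (`¬p i`), radius `ρ`, `r := s + ρ`, `q < 1`: for every target `v ∈ SU(N)` with
  `‖v − V̄‖ ≤ ρ − ((m∕|ι|) r + 36 r²)` the Picard map `W ↦ E_V(W)⁻¹·v` is a `q`-contraction of the closed `ρ`-ball about `V̄` in `SU(N)` into itself, so there is `W` in
  that ball with `F_V W = v` (Banach, `ContractingWith.exists_fixedPoint'`; `SU(N)` is compact hence complete) — unique there by ★.
* ★★★ **`oneBond_preimage_lipschitz`** — two solutions `F_V W = v`, `F_{V′} W′ = v′` in one family ball for both environments, `‖V_i − V′_i‖ ≤ d ≤ 1∕24`, satisfy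
  `(1 − q)·‖W − W′‖ ≤ ‖v − v′‖ + 12 d`: the local inverse is JOINTLY LIPSCHITZ in the target and in the environment (so continuous and measurable where defined)
  — the `hθc` letter of the triangular chart, in quantitative form.

HOW (L5) READS IT: at a coarse bond `c` and environment `U`, `V := BlockAveragingHaarAC.openHol U c`, `p := BlockAveragingHaarAC.IsCentral c`, and the argument
`W := pre U c · g · post U c` of the private coordinate `g` — by ✓`BlockAveragingEMLHaarAC.fibreFamily` (this file's family IS its shape) and
✓`BlockAveragingEMLHaarAC.avgFun_update_centralBond_self` (`Ū′(c) = fibreMap (pre·g·post)`); the packaged local inverse (∃θ, global in the environment, jointly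
Lipschitz) is the sequel `FluctuationComparisonRegPrIntLOneBondLocalInverse`.

## What this is NOT

Not the inverse LAW: the change-of-variables identity `haar⌊Ω = θ_*(jac·haar⌊T)` with a continuous Jacobian (Stage 2: `HaarExpChartChangeOfVariables` + the inverse
function theorem on `T4EMLTangentInjective.hasStrictFDerivAt_Kmat`) is NOT here; nor the spread-lift (MASS) inequality; nor any statement about `descend`, towers,
VER∘, O1, crux stmt-QuantumFields-20520 or `YM3TorusSU2` — none of which is proved by this file.  No `def`, `instance`, `notation`, `sorry`, `axiom`.
-/

noncomputable section

open Set Metric NormedSpace Function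

namespace Summit.QuantumFields.YangMills.Theorems.FluctuationComparisonRegPrIntLOneBondInverse

open Literature.MathematicalPhysics.QuantumFieldTheory.Balaban1983to89

open B7TransferAnalyticMean (meanCLM meanCLM_apply norm_meanCLM_apply_le)
open ExpMeanLog (eml deltaSU expMeanLogSU lt_third_of_lt_deltaSU)
open BlockAveragingEMLAnalyticMean (norm_eml_add_sub_eml_le)
open Summit.QuantumFields.YangMills.Theorems.FluctuationComparisonRegPrIntLOneBondFamily

/-! ## §3 The one-bond map on `SU(N)`: injectivity, the fixed-point inverse, Lipschitz dependence -/

section SUN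

open scoped Matrix.Norms.L2Operator
open BlockAveragingEMLProp2 (coe_avg_eq_eml)

variable {n : Type*} [Fintype n] [DecidableEq n] [Nonempty n] {ι : Type*} [Fintype ι] [Nonempty ι]

omit [Nonempty n] in
/-- Elements of `SU(N)` are unitary matrices (file-private copy of a tree lemma, kept private to spare an import). [folklore] -/
private theorem coe_mem_unitaryGroup (g : Matrix.specialUnitaryGroup n ℂ) : (g : Matrix n n ℂ) ∈ Matrix.unitaryGroup n ℂ :=
  (Matrix.mem_specialUnitaryGroup_iff.1 g.2).1

omit [Nonempty n] in
/-- The distance of `SU(N)` is the operator-norm distance of the matrices. [folklore] -/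
theorem dist_su_eq (g h : Matrix.specialUnitaryGroup n ℂ) : dist g h = ‖(g : Matrix n n ℂ) - (h : Matrix n n ℂ)‖ := by
  rw [Subtype.dist_eq, dist_eq_norm]

omit [Fintype ι] [Nonempty n] [Nonempty ι] in
/-- **THE ONE-BOND FAMILY IN THE MATRIX MODEL** (the shape of `BlockAveragingEMLHaarAC.fibreFamily`): coercing `i ↦ (p i ? 1 : V_i·W⁻¹)` to matrices gives
`i ↦ (p i ? 1 : V_i·W*)`. [cite: Balaban1987RG1, (0.4) p.253 (bookkeeping)] -/
theorem coe_fam (p : ι → Prop) [DecidablePred p] (V : ι → Matrix.specialUnitaryGroup n ℂ) (W : Matrix.specialUnitaryGroup n ℂ) :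
    (fun i => (((if p i then (1 : Matrix.specialUnitaryGroup n ℂ) else V i * W⁻¹) : Matrix.specialUnitaryGroup n ℂ) : Matrix n n ℂ)) =
      fun i => if p i then (1 : Matrix n n ℂ) else (V i : Matrix n n ℂ) * star (W : Matrix n n ℂ) := by
  funext i
  split_ifs with hi <;> rfl

/-- **ON THE FAMILY BALL THE GUARDED AVERAGE IS `eml` OF THE MATRIX FAMILY** (`r < δ_N`). [cite: Balaban1987RG1, (0.4) p.253] -/
theorem coe_avg_fam (p : ι → Prop) [DecidablePred p] (V : ι → Matrix.specialUnitaryGroup n ℂ) (W : Matrix.specialUnitaryGroup n ℂ)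
    {r : ℝ} (hrδ : r < deltaSU n) (h : ∀ i, ¬ p i → ‖(V i : Matrix n n ℂ) - (W : Matrix n n ℂ)‖ ≤ r) :
    (((expMeanLogSU (n := n)).avg (fun i => if p i then (1 : Matrix.specialUnitaryGroup n ℂ) else V i * W⁻¹) : Matrix.specialUnitaryGroup n ℂ) :
        Matrix n n ℂ) =
      eml (fun i => if p i then (1 : Matrix n n ℂ) else (V i : Matrix n n ℂ) * star (W : Matrix n n ℂ)) := by
  have hsmall : ∀ i, dist1 ((if p i then (1 : Matrix.specialUnitaryGroup n ℂ) else V i * W⁻¹)) < deltaSU n := by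
    intro i
    split_ifs with hi
    · rw [GaugeGroup.dist1_one]; exact ExpMeanLog.deltaSU_pos
    · show ‖(V i : Matrix n n ℂ) * star (W : Matrix n n ℂ) - 1‖ < deltaSU n
      rw [norm_mul_star_sub_one _ (coe_mem_unitaryGroup W)]
      exact (h i hi).trans_lt hrδ
  rw [coe_avg_eq_eml _ hsmall, coe_fam]

/-- **`E_V` IS `q := m∕|ι| + 144 r`-LIPSCHITZ ON `SU(N)`'s FAMILY BALL** (`r ≤ 1∕24`, `r < δ_N`). [cite: Balaban1987RG1, (0.4)/(0.8) p.253] -/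
theorem norm_avg_fam_sub_le (p : ι → Prop) [DecidablePred p] (V : ι → Matrix.specialUnitaryGroup n ℂ) {r : ℝ} (hr0 : 0 ≤ r)
    (hr : r ≤ 1 / 24) (hrδ : r < deltaSU n) {W₁ W₂ : Matrix.specialUnitaryGroup n ℂ}
    (h₁ : ∀ i, ¬ p i → ‖(V i : Matrix n n ℂ) - (W₁ : Matrix n n ℂ)‖ ≤ r) (h₂ : ∀ i, ¬ p i → ‖(V i : Matrix n n ℂ) - (W₂ : Matrix n n ℂ)‖ ≤ r) :
    ‖(((expMeanLogSU (n := n)).avg (fun i => if p i then (1 : Matrix.specialUnitaryGroup n ℂ) else V i * W₁⁻¹) : Matrix.specialUnitaryGroup n ℂ) :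
        Matrix n n ℂ) -
      (((expMeanLogSU (n := n)).avg (fun i => if p i then (1 : Matrix.specialUnitaryGroup n ℂ) else V i * W₂⁻¹) : Matrix.specialUnitaryGroup n ℂ) :
        Matrix n n ℂ)‖ ≤
      (((Finset.univ.filter fun i => ¬ p i).card : ℝ) / (Fintype.card ι : ℝ) + 144 * r) * ‖(W₁ : Matrix n n ℂ) - (W₂ : Matrix n n ℂ)‖ := by
  rw [coe_avg_fam p V W₁ hrδ h₁, coe_avg_fam p V W₂ hrδ h₂]
  exact norm_eml_fam_sub_le p (V := fun i => (V i : Matrix n n ℂ)) (fun i _ => coe_mem_unitaryGroup (V i)) hr0 hr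
    (coe_mem_unitaryGroup W₁) (coe_mem_unitaryGroup W₂) h₁ h₂

/-- **`‖E_V(W) − 1‖ ≤ (m∕|ι|) r + 36 r²`** on `SU(N)`'s family ball (`r ≤ 1∕12`, `r < δ_N`). [cite: Balaban1987RG1, (0.8) p.253] -/
theorem norm_avg_fam_sub_one_le (p : ι → Prop) [DecidablePred p] (V : ι → Matrix.specialUnitaryGroup n ℂ) {r : ℝ} (hr0 : 0 ≤ r)
    (hr : r ≤ 1 / 12) (hrδ : r < deltaSU n) {W : Matrix.specialUnitaryGroup n ℂ} (h : ∀ i, ¬ p i → ‖(V i : Matrix n n ℂ) - (W : Matrix n n ℂ)‖ ≤ r) :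
    ‖(((expMeanLogSU (n := n)).avg (fun i => if p i then (1 : Matrix.specialUnitaryGroup n ℂ) else V i * W⁻¹) : Matrix.specialUnitaryGroup n ℂ) :
        Matrix n n ℂ) - 1‖ ≤
      ((Finset.univ.filter fun i => ¬ p i).card : ℝ) / (Fintype.card ι : ℝ) * r + 36 * r ^ 2 := by
  rw [coe_avg_fam p V W hrδ h]
  exact norm_eml_fam_sub_one_le p (fun i => (V i : Matrix n n ℂ)) (coe_mem_unitaryGroup W) hr0 hr h

/-- ★ **THE ONE-BOND MAP `F_V(W) = E_V(W)·W` IS INJECTIVE ON THE FAMILY BALL** as soon as `q = m∕|ι| + 144 r < 1`: from `E₁W₁ = E₂W₂` one gets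
`W₁ − W₂ = E₁*(E₂ − E₁)W₂`, so `‖W₁ − W₂‖ ≤ q‖W₁ − W₂‖`. [cite: Balaban1987RG1, (0.4) p.253 and (2.4) p.266] -/
theorem oneBond_injOn (p : ι → Prop) [DecidablePred p] (V : ι → Matrix.specialUnitaryGroup n ℂ) {r : ℝ} (hr0 : 0 ≤ r)
    (hr : r ≤ 1 / 24) (hrδ : r < deltaSU n)
    (hq : ((Finset.univ.filter fun i => ¬ p i).card : ℝ) / (Fintype.card ι : ℝ) + 144 * r < 1) :
    InjOn (fun W : Matrix.specialUnitaryGroup n ℂ =>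
        (expMeanLogSU (n := n)).avg (fun i => if p i then (1 : Matrix.specialUnitaryGroup n ℂ) else V i * W⁻¹) * W)
      {W | ∀ i, ¬ p i → ‖(V i : Matrix n n ℂ) - (W : Matrix n n ℂ)‖ ≤ r} := by
  intro W₁ h₁ W₂ h₂ hF
  set E₁ : Matrix.specialUnitaryGroup n ℂ :=
    (expMeanLogSU (n := n)).avg (fun i => if p i then (1 : Matrix.specialUnitaryGroup n ℂ) else V i * W₁⁻¹) with hE₁
  set E₂ : Matrix.specialUnitaryGroup n ℂ :=
    (expMeanLogSU (n := n)).avg (fun i => if p i then (1 : Matrix.specialUnitaryGroup n ℂ) else V i * W₂⁻¹) with hE₂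
  have hF' : (E₁ : Matrix n n ℂ) * (W₁ : Matrix n n ℂ) = (E₂ : Matrix n n ℂ) * (W₂ : Matrix n n ℂ) := by
    have := congrArg (fun g : Matrix.specialUnitaryGroup n ℂ => (g : Matrix n n ℂ)) hF
    simpa using this
  -- `W₁ − W₂ = E₁* (E₂ − E₁) W₂`
  have hE₁u := coe_mem_unitaryGroup E₁
  have e : (W₁ : Matrix n n ℂ) - (W₂ : Matrix n n ℂ) = star (E₁ : Matrix n n ℂ) * ((E₂ : Matrix n n ℂ) - (E₁ : Matrix n n ℂ)) * (W₂ : Matrix n n ℂ) := by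
    rw [mul_sub, sub_mul, mul_assoc, ← hF', ← mul_assoc, Unitary.star_mul_self_of_mem hE₁u, one_mul, one_mul]
  have hle : ‖(W₁ : Matrix n n ℂ) - (W₂ : Matrix n n ℂ)‖ ≤
      (((Finset.univ.filter fun i => ¬ p i).card : ℝ) / (Fintype.card ι : ℝ) + 144 * r) * ‖(W₁ : Matrix n n ℂ) - (W₂ : Matrix n n ℂ)‖ := by
    calc ‖(W₁ : Matrix n n ℂ) - (W₂ : Matrix n n ℂ)‖ = ‖(E₂ : Matrix n n ℂ) - (E₁ : Matrix n n ℂ)‖ := by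
          rw [e, CStarRing.norm_mul_mem_unitary _ (coe_mem_unitaryGroup W₂), norm_unitary_mul _ (Unitary.star_mem hE₁u)]
      _ = ‖(E₁ : Matrix n n ℂ) - (E₂ : Matrix n n ℂ)‖ := norm_sub_rev _ _
      _ ≤ _ := norm_avg_fam_sub_le p V hr0 hr hrδ h₁ h₂
  have h0 : ‖(W₁ : Matrix n n ℂ) - (W₂ : Matrix n n ℂ)‖ = 0 := by
    nlinarith [norm_nonneg ((W₁ : Matrix n n ℂ) - (W₂ : Matrix n n ℂ))]
  exact Subtype.ext (sub_eq_zero.1 (norm_eq_zero.1 h0))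

/-- ★★ **EXISTENCE OF THE PREIMAGE BY BANACH ITERATION.**  Centre `V̄ ∈ SU(N)`, spread `‖V_i − V̄‖ ≤ s` at the off-central indices, radius `ρ`,
`r := s + ρ ≤ 1∕24`, `r < δ_N`, `q := m∕|ι| + 144 r < 1`: for every target `v` with `‖v − V̄‖ ≤ ρ − ((m∕|ι|) r + 36 r²)` the Picard map
`W ↦ E_V(W)⁻¹·v` is a `q`-contraction of the closed `ρ`-ball about `V̄` in `SU(N)` into itself, hence there is `W` in that ball with `E_V(W)·W = v`.
[cite: Balaban1987RG1, (0.4) p.253 and (2.4) p.266] -/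
theorem oneBond_exists_preimage (p : ι → Prop) [DecidablePred p] (V : ι → Matrix.specialUnitaryGroup n ℂ)
    (Vbar : Matrix.specialUnitaryGroup n ℂ) {s ρ : ℝ} (hs0 : 0 ≤ s) (hρ0 : 0 ≤ ρ)
    (hs : ∀ i, ¬ p i → ‖(V i : Matrix n n ℂ) - (Vbar : Matrix n n ℂ)‖ ≤ s)
    (hr : s + ρ ≤ 1 / 24) (hrδ : s + ρ < deltaSU n)
    (hq : ((Finset.univ.filter fun i => ¬ p i).card : ℝ) / (Fintype.card ι : ℝ) + 144 * (s + ρ) < 1)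
    (v : Matrix.specialUnitaryGroup n ℂ)
    (hv : ‖(v : Matrix n n ℂ) - (Vbar : Matrix n n ℂ)‖ ≤
      ρ - (((Finset.univ.filter fun i => ¬ p i).card : ℝ) / (Fintype.card ι : ℝ) * (s + ρ) + 36 * (s + ρ) ^ 2)) :
    ∃ W : Matrix.specialUnitaryGroup n ℂ, ‖(W : Matrix n n ℂ) - (Vbar : Matrix n n ℂ)‖ ≤ ρ ∧
      (expMeanLogSU (n := n)).avg (fun i => if p i then (1 : Matrix.specialUnitaryGroup n ℂ) else V i * W⁻¹) * W = v := by
  set μ : ℝ := ((Finset.univ.filter fun i => ¬ p i).card : ℝ) / (Fintype.card ι : ℝ) with hμ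
  have hμ0 : 0 ≤ μ := by positivity
  set q : ℝ := μ + 144 * (s + ρ) with hqdef
  have hq0 : 0 ≤ q := by positivity
  -- the ball and the Picard map
  set B : Set (Matrix.specialUnitaryGroup n ℂ) := {W | ‖(W : Matrix n n ℂ) - (Vbar : Matrix n n ℂ)‖ ≤ ρ} with hB
  set T : Matrix.specialUnitaryGroup n ℂ → Matrix.specialUnitaryGroup n ℂ := fun W =>
    ((expMeanLogSU (n := n)).avg (fun i => if p i then (1 : Matrix.specialUnitaryGroup n ℂ) else V i * W⁻¹))⁻¹ * v with hT
  -- on the ball every off-central `V_i` is within `r = s + ρ` of `W`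
  have hfam : ∀ W ∈ B, ∀ i, ¬ p i → ‖(V i : Matrix n n ℂ) - (W : Matrix n n ℂ)‖ ≤ s + ρ := by
    intro W hW i hi
    calc ‖(V i : Matrix n n ℂ) - (W : Matrix n n ℂ)‖
        = ‖((V i : Matrix n n ℂ) - (Vbar : Matrix n n ℂ)) + ((Vbar : Matrix n n ℂ) - (W : Matrix n n ℂ))‖ := by rw [sub_add_sub_cancel]
      _ ≤ s + ρ := (norm_add_le _ _).trans (add_le_add (hs i hi) (by rw [norm_sub_rev]; exact hW))
  -- `T` maps the ball into itself
  have hmaps : MapsTo T B B := by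
    intro W hW
    set E : Matrix.specialUnitaryGroup n ℂ :=
      (expMeanLogSU (n := n)).avg (fun i => if p i then (1 : Matrix.specialUnitaryGroup n ℂ) else V i * W⁻¹) with hE
    have hEu := coe_mem_unitaryGroup E
    have hE1 : ‖(E : Matrix n n ℂ) - 1‖ ≤ μ * (s + ρ) + 36 * (s + ρ) ^ 2 :=
      norm_avg_fam_sub_one_le p V (by positivity) (by linarith) hrδ (hfam W hW)
    show ‖((E⁻¹ * v : Matrix.specialUnitaryGroup n ℂ) : Matrix n n ℂ) - (Vbar : Matrix n n ℂ)‖ ≤ ρ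
    have ecoe : ((E⁻¹ * v : Matrix.specialUnitaryGroup n ℂ) : Matrix n n ℂ) = star (E : Matrix n n ℂ) * (v : Matrix n n ℂ) := rfl
    rw [ecoe]
    have e : star (E : Matrix n n ℂ) * (v : Matrix n n ℂ) - (Vbar : Matrix n n ℂ) =
        (star (E : Matrix n n ℂ) - 1) * (v : Matrix n n ℂ) + ((v : Matrix n n ℂ) - (Vbar : Matrix n n ℂ)) := by
      rw [sub_mul, one_mul]; abel
    rw [e]
    calc ‖(star (E : Matrix n n ℂ) - 1) * (v : Matrix n n ℂ) + ((v : Matrix n n ℂ) - (Vbar : Matrix n n ℂ))‖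
        ≤ ‖(star (E : Matrix n n ℂ) - 1) * (v : Matrix n n ℂ)‖ + ‖(v : Matrix n n ℂ) - (Vbar : Matrix n n ℂ)‖ := norm_add_le _ _
      _ = ‖(E : Matrix n n ℂ) - 1‖ + ‖(v : Matrix n n ℂ) - (Vbar : Matrix n n ℂ)‖ := by
          have hst : ‖star (E : Matrix n n ℂ) - 1‖ = ‖(E : Matrix n n ℂ) - 1‖ := by
            rw [← norm_star (star (E : Matrix n n ℂ) - 1), star_sub, star_star, star_one]
          rw [CStarRing.norm_mul_mem_unitary _ (coe_mem_unitaryGroup v), hst]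
      _ ≤ ρ := by linarith
  -- `T` is a `q`-contraction on the ball
  have hlip : ∀ W₁ ∈ B, ∀ W₂ ∈ B, dist (T W₁) (T W₂) ≤ q * dist W₁ W₂ := by
    intro W₁ hW₁ W₂ hW₂
    set E₁ : Matrix.specialUnitaryGroup n ℂ :=
      (expMeanLogSU (n := n)).avg (fun i => if p i then (1 : Matrix.specialUnitaryGroup n ℂ) else V i * W₁⁻¹) with hE₁
    set E₂ : Matrix.specialUnitaryGroup n ℂ :=
      (expMeanLogSU (n := n)).avg (fun i => if p i then (1 : Matrix.specialUnitaryGroup n ℂ) else V i * W₂⁻¹) with hE₂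
    rw [dist_su_eq, dist_su_eq]
    show ‖star (E₁ : Matrix n n ℂ) * (v : Matrix n n ℂ) - star (E₂ : Matrix n n ℂ) * (v : Matrix n n ℂ)‖ ≤ q * ‖(W₁ : Matrix n n ℂ) - (W₂ : Matrix n n ℂ)‖
    rw [← sub_mul, CStarRing.norm_mul_mem_unitary _ (coe_mem_unitaryGroup v), ← star_sub, norm_star]
    exact norm_avg_fam_sub_le p V (by positivity) hr hrδ (hfam W₁ hW₁) (hfam W₂ hW₂)
  have hK : ContractingWith ⟨q, hq0⟩ (hmaps.restrict T B B) := by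
    refine ⟨by exact_mod_cast hq, LipschitzWith.of_dist_le_mul fun x y => ?_⟩
    rw [Subtype.dist_eq, Subtype.dist_eq]
    exact hlip x.1 x.2 y.1 y.2
  -- the ball is complete (closed in the compact `SU(N)`) and contains the centre
  have hBc : IsComplete B := by
    refine IsClosed.isComplete ?_
    exact isClosed_le ((continuous_subtype_val.sub continuous_const).norm) continuous_const
  have hVbar : Vbar ∈ B := by
    show ‖(Vbar : Matrix n n ℂ) - (Vbar : Matrix n n ℂ)‖ ≤ ρ
    rw [sub_self, norm_zero]; exact hρ0
  obtain ⟨W, hWB, hfix, -, -⟩ := hK.exists_fixedPoint' hBc hmaps hVbar (edist_ne_top _ _)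
  refine ⟨W, hWB, ?_⟩
  -- a fixed point of the Picard map is a preimage
  have hfix' : ((expMeanLogSU (n := n)).avg (fun i => if p i then (1 : Matrix.specialUnitaryGroup n ℂ) else V i * W⁻¹))⁻¹ * v = W := hfix
  rw [← hfix', ← mul_assoc]
  conv_lhs => rw [hfix']
  rw [mul_inv_cancel, one_mul]

/-- ★★★ **LIPSCHITZ DEPENDENCE OF THE PREIMAGE ON THE TARGET AND ON THE ENVIRONMENT.**  Two solutions `E_V(W)·W = v`, `E_{V′}(W′)·W′ = v′` lying in one
family ball of radius `r ≤ 1∕24` (`r < δ_N`) for both environments, with `‖V_i − V′_i‖ ≤ d ≤ 1∕24`, satisfy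
`(1 − q)·‖W − W′‖ ≤ ‖v − v′‖ + 12 d`.  (In particular the local inverse is unique and jointly continuous.) [cite: Balaban1987RG1, (0.4) p.253 and (2.4) p.266] -/
theorem oneBond_preimage_lipschitz (p : ι → Prop) [DecidablePred p] (V V' : ι → Matrix.specialUnitaryGroup n ℂ) {r d : ℝ}
    (hr0 : 0 ≤ r) (hr : r ≤ 1 / 24) (hrδ : r < deltaSU n) (hd0 : 0 ≤ d) (hd : d ≤ 1 / 24)
    (hVV' : ∀ i, ¬ p i → ‖(V i : Matrix n n ℂ) - (V' i : Matrix n n ℂ)‖ ≤ d)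
    {W W' v v' : Matrix.specialUnitaryGroup n ℂ}
    (hW : ∀ i, ¬ p i → ‖(V i : Matrix n n ℂ) - (W : Matrix n n ℂ)‖ ≤ r) (hW' : ∀ i, ¬ p i → ‖(V i : Matrix n n ℂ) - (W' : Matrix n n ℂ)‖ ≤ r)
    (hW'' : ∀ i, ¬ p i → ‖(V' i : Matrix n n ℂ) - (W' : Matrix n n ℂ)‖ ≤ r)
    (hv : (expMeanLogSU (n := n)).avg (fun i => if p i then (1 : Matrix.specialUnitaryGroup n ℂ) else V i * W⁻¹) * W = v)
    (hv' : (expMeanLogSU (n := n)).avg (fun i => if p i then (1 : Matrix.specialUnitaryGroup n ℂ) else V' i * W'⁻¹) * W' = v') :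
    (1 - (((Finset.univ.filter fun i => ¬ p i).card : ℝ) / (Fintype.card ι : ℝ) + 144 * r)) * ‖(W : Matrix n n ℂ) - (W' : Matrix n n ℂ)‖ ≤
      ‖(v : Matrix n n ℂ) - (v' : Matrix n n ℂ)‖ + 12 * d := by
  set E : Matrix.specialUnitaryGroup n ℂ :=
    (expMeanLogSU (n := n)).avg (fun i => if p i then (1 : Matrix.specialUnitaryGroup n ℂ) else V i * W⁻¹) with hE
  set E₁ : Matrix.specialUnitaryGroup n ℂ :=
    (expMeanLogSU (n := n)).avg (fun i => if p i then (1 : Matrix.specialUnitaryGroup n ℂ) else V i * W'⁻¹) with hE₁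
  set E' : Matrix.specialUnitaryGroup n ℂ :=
    (expMeanLogSU (n := n)).avg (fun i => if p i then (1 : Matrix.specialUnitaryGroup n ℂ) else V' i * W'⁻¹) with hE'
  -- `W = E* v`, `W′ = E′* v′`
  have hWv : (W : Matrix n n ℂ) = star (E : Matrix n n ℂ) * (v : Matrix n n ℂ) := by
    have h1 : ((E * W : Matrix.specialUnitaryGroup n ℂ) : Matrix n n ℂ) = (v : Matrix n n ℂ) := by rw [hv]
    have h2 : (E : Matrix n n ℂ) * (W : Matrix n n ℂ) = (v : Matrix n n ℂ) := h1
    rw [← h2, ← mul_assoc, Unitary.star_mul_self_of_mem (coe_mem_unitaryGroup E), one_mul]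
  have hWv' : (W' : Matrix n n ℂ) = star (E' : Matrix n n ℂ) * (v' : Matrix n n ℂ) := by
    have h1 : ((E' * W' : Matrix.specialUnitaryGroup n ℂ) : Matrix n n ℂ) = (v' : Matrix n n ℂ) := by rw [hv']
    have h2 : (E' : Matrix n n ℂ) * (W' : Matrix n n ℂ) = (v' : Matrix n n ℂ) := h1
    rw [← h2, ← mul_assoc, Unitary.star_mul_self_of_mem (coe_mem_unitaryGroup E'), one_mul]
  -- the two increments of `E`
  have hA : ‖(E : Matrix n n ℂ) - (E₁ : Matrix n n ℂ)‖ ≤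
      (((Finset.univ.filter fun i => ¬ p i).card : ℝ) / (Fintype.card ι : ℝ) + 144 * r) * ‖(W : Matrix n n ℂ) - (W' : Matrix n n ℂ)‖ :=
    norm_avg_fam_sub_le p V hr0 hr hrδ hW hW'
  have hB : ‖(E₁ : Matrix n n ℂ) - (E' : Matrix n n ℂ)‖ ≤ 12 * d := by
    rw [hE₁, hE', coe_avg_fam p V W' hrδ hW', coe_avg_fam p V' W' hrδ hW'']
    set f : ι → Matrix n n ℂ := fun i => if p i then (1 : Matrix n n ℂ) else (V i : Matrix n n ℂ) * star (W' : Matrix n n ℂ) with hf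
    set f' : ι → Matrix n n ℂ := fun i => if p i then (1 : Matrix n n ℂ) else (V' i : Matrix n n ℂ) * star (W' : Matrix n n ℂ) with hf'
    have hf1 : ‖f - 1‖ ≤ 1 / 6 :=
      (norm_fam_sub_one_le p (fun i => (V i : Matrix n n ℂ)) (coe_mem_unitaryGroup W') hr0 hW').trans (by linarith)
    have hΔ : ‖f' - f‖ ≤ d := by
      refine (pi_norm_le_iff_of_nonneg hd0).2 fun i => ?_
      simp only [hf, hf', Pi.sub_apply]
      split_ifs with hi
      · rw [sub_self, norm_zero]; exact hd0
      · rw [← sub_mul, norm_mul_star_of_mem_unitary _ (coe_mem_unitaryGroup W'), norm_sub_rev]; exact hVV' i hi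
    have h12 := norm_eml_add_sub_eml_le (ι := ι) (𝔸 := Matrix n n ℂ) (U := f) (V := f' - f) hf1 (hΔ.trans hd)
    rw [add_sub_cancel] at h12
    rw [norm_sub_rev]
    exact h12.trans (by nlinarith)
  -- assemble: `W − W′ = E*(v − v′) + (E* − E′*) v′`
  have e : (W : Matrix n n ℂ) - (W' : Matrix n n ℂ) =
      star (E : Matrix n n ℂ) * ((v : Matrix n n ℂ) - (v' : Matrix n n ℂ)) + (star (E : Matrix n n ℂ) - star (E' : Matrix n n ℂ)) * (v' : Matrix n n ℂ) := by
    rw [hWv, hWv', mul_sub, sub_mul]; abel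
  have hmain : ‖(W : Matrix n n ℂ) - (W' : Matrix n n ℂ)‖ ≤ ‖(v : Matrix n n ℂ) - (v' : Matrix n n ℂ)‖ + ‖(E : Matrix n n ℂ) - (E' : Matrix n n ℂ)‖ := by
    rw [e]
    refine (norm_add_le _ _).trans (add_le_add ?_ ?_)
    · rw [norm_unitary_mul _ (Unitary.star_mem (coe_mem_unitaryGroup E))]
    · rw [CStarRing.norm_mul_mem_unitary _ (coe_mem_unitaryGroup v'), ← star_sub, norm_star]
  have htri : ‖(E : Matrix n n ℂ) - (E' : Matrix n n ℂ)‖ ≤ ‖(E : Matrix n n ℂ) - (E₁ : Matrix n n ℂ)‖ + ‖(E₁ : Matrix n n ℂ) - (E' : Matrix n n ℂ)‖ := by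
    rw [← sub_add_sub_cancel]; exact norm_add_le _ _
  nlinarith [norm_nonneg ((W : Matrix n n ℂ) - (W' : Matrix n n ℂ))]

end SUN

end Summit.QuantumFields.YangMills.Theorems.FluctuationComparisonRegPrIntLOneBondInverse
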